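import Summits.QuantumFields.BalabanUV.Beta.RowD1JointEndSymReflTablesAn1S2MW
import Summits.QuantumFields.BalabanUV.Beta.SymVhSliceReflectionAn1

/-!
# `BalabanUV.Beta.RowD1JointEndSymReflTablesAn1S2MWV` — binder row D1: **THE LITERAL ROOT AT an1's CLOSED (0.4) TABLE RECORD WITH THE hW CLASS, THE FOUR
# FIRST-ORDER hR TABLE REFLECTION LETTERS (V-r)×3 (H-r) AND THE SECOND UNITS LOCK DISCHARGED** — ROOT H `RowD1JointEndSymReflTablesAn1S2MW` (this gen, p297092)
# with `hVfm := hVfm_sym hLc`, `hVmf := hVmf_sym hLc`, `hVmm := hVmm_sym hLc` SUPPLIED by an1-g43's S2e #2 `SymVhSliceReflectionAn1` and `hHr := hHr_sym hLc` by S2e #1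
# (the reflection law of an1's (0.4)-symmetrised first-order border table `symVhSAt ρ_c` with its contact term `conjV (bhK + Dsh) (Lc⁻⁴ • diagK ctGenM)` and of the
# constraint Hessian `symHessFFAt ρ_c`, UNCONDITIONAL for odd `Lc`; over S2e #1 `SymRootedKernelReflection(Core)`), and `hlock2` PROVED (it is an identity of the
# weights at `d = 3`: `Lc⁸·(Lc^{j+1})²⁰·(Lc^{j+1})¹⁰ = (Lc⁴·(Lc^{j+1})¹⁵)²`) — five binders fewer
# (β sub-cell, BINDER-OWNERS row D1 OWNER `b2b-balaban-beta-an2` gen 32, brick (N9d) «ROOT I», ruling R-D1-g32-2)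

HONEST FRAMING (cell contract, verbatim): «discharging `BetaPertH` makes Bałaban's UV stability UNCONDITIONAL — a real constructive-QFT result; it is
NOT the continuum limit and NOT the Clay problem.»  HONEST DEPENDENCY: continuum YM on T⁴ ⇐ BetaPertH ∧ nine spine estimates (0/9 proved);
BetaPertH ⇐ (D1) ∧ (D4) ∧ CAP+tail; G-an2-4 gates asym, D1 and NE2/3/4.
DERIVED cell leaf ([folklore] wiring BY NAME).  No statement of Bałaban's papers, no `[cite:]`, no `Prop` fact, no `def`.  EVERY hypothesis below is a displayed
BINDER.  WHAT REMAINS DISPLAYED (all about an1's CONCRETE tables): `2 ≤ N`; the two unit locks `hΛ` ∕ `hcB`; the first-order contact coefficient `γ` (`hγ`); hR =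
the SECOND-ORDER table reflection letters ONLY — (h0) level 0, (W-0B) `hBfm hBmf hBmm` ∀ j+1 with `RBr` (`hRBrff`), `h2`, `R2` (`hR2succ`), the split `hsplit` (with
the explicit `symRMrAn1 Lc cΛ γ`), the localisations `hDg hX2L hΔL`, and `hcomp`-at-`Rm` (the (N8) identity); D1Tel, D1Rep, the printed B5 facts, the window.
hW = NOTHING; hR FIRST ORDER = NOTHING.  OWNER's word: classes hW EMPTY, hR reduced to its second-order letters; root-level classes unchanged in NUMBER by this
file beyond ROOT H (the referee's census word is theirs).  HONEST: composition by name; NOT D1, NOT `BetaPertH`, NOT continuum, NOT Clay.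
Provenance: β sub-cell, unit beta-an2 gen 32 (row OWNER), 2026-08-21 (v1); over `RowD1JointEndSymReflTablesAn1S2MW` (this gen) and an1-g43's
`SymVhSliceReflectionAn1` (S2e #2) ∕ `SymRootedKernelReflection` (S2e #1; courier d1-formalise-leaf-05 g21) BY NAME; no existing file touched.
-/

noncomputable section

open Finset
open scoped BigOperators
open Literature.Probability.LatticeModels (Torus.proj)
open Literature.MathematicalPhysics.QuantumFieldTheory
open Literature.MathematicalPhysics.QuantumFieldTheory.Balaban1983to89
open Literature.MathematicalPhysics.QuantumFieldTheory.Balaban1983to89.Beta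
open Literature.MathematicalPhysics.QuantumFieldTheory.Balaban1983to89.Beta.VectorTailsLoc (fam kfam)
open Literature.MathematicalPhysics.QuantumFieldTheory.Balaban1983to89.Beta.VectorLegVolumeAdapter (MvE)
open ExpKernelCalculus (MKer BiLoc VertexFamily comp tr tadpole shiftK)
open PolarizationSign (reflSign WardTransversal AxisReflectionCovariant)
open KernelReflection (refK)
open ResolventReflection (bref Φ)
open AffineAveraging (box toSite)
open AveragingContoursRooted (ctr ctrOff ctrOff_mem_box)
open OneStepResolventKernel (Fib LocStencil JetData)
open OneStepKernelFamily (KInvStep colH vertexOfK TbalOf flipK D1Tel D1Rep D1Drift)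
open KernelWard (divV divW)
open StepJetData (mfNeg wilsonA)
open BalabanStepJetsSucc (mmRead wE wVH)
open SecondOrderResponse (dM W2OfK LocStencilFM)
open BalabanCompositeJets (LocStencil₂)
open BalabanStepW2 (M2Of wB2 wV4)
open WilsonBiStencil (wilsonW₂)
open WilsonVertex2Sym (wsym22)
open Summit.QuantumFields.BalabanUV.Beta.TameKernelCalculus
open Summit.QuantumFields.BalabanUV.Beta.ChartConjugation (conjV conjW)
open Summit.QuantumFields.BalabanUV.Beta.ChartConjugationDefectEnd (conjDefect sandwichDefect)
open Summit.QuantumFields.BalabanUV.Beta.AxialDressingRooted (one_le_of_neZero)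
open Summit.QuantumFields.BalabanUV.Beta.SymmetrisedDressingKernel (coDressKSymAt)
open Summit.QuantumFields.BalabanUV.Beta.AveragingWardRootedStencils (legInd)
open Summit.QuantumFields.BalabanUV.Beta.SymmetrisedStepJets (SymTables Gsym SsymOf SpureSymOf JsB12Sym0 JsB12Sym)
open Summit.QuantumFields.BalabanUV.Beta.SpineRooted (M1Of SpureRecOf T2RecOf WrecOf)
open Summit.QuantumFields.BalabanUV.Beta.WardLocusRecursive (SrecOf)
open Summit.QuantumFields.BalabanUV.Beta.WardLocusCubic (mmSym)
open Summit.QuantumFields.BalabanUV.Beta.SymShiftedSpread (bhKStepSh)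
open Summit.QuantumFields.BalabanUV.Beta.BorderedHessian (sgnK bhK stepScale diagK)
open Summit.QuantumFields.BalabanUV.Beta.E3ContactGenerator (ctGenM)
open Summit.QuantumFields.BalabanUV.Beta.DshAn1 (Dsh)
open Summit.QuantumFields.BalabanUV.Beta.SymAveragingHessianCounts (symVhSAt symHessFFAt)
open Summit.QuantumFields.BalabanUV.Beta.SymAveragingMixedJetTables (symMixFFAt)
open Summit.QuantumFields.BalabanUV.Beta.SymSecondOrderTablesAn1 (symVh₂SAn1 symTablesAn1S2 locStencil₂_symVh₂SAn1 symVh₂SAn1_hBt symVh₂SAn1_inl_inl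
  symMixFFAt_hmix_ctr symMixFFAt_hmixt)
open Summit.QuantumFields.BalabanUV.Beta.RowD1JointEndSymReflTablesAn1S2 (d1Drift_JsB12Sym_an1TablesS2_of_bordMixLetters_reflTableLetters_D1Tel_D1Rep)
open Summit.QuantumFields.BalabanUV.Beta.SymMixedReflectionLetterAn1 (symRMrAn1 hM2_symMixFFAt)

open Summit.QuantumFields.BalabanUV.Beta.RowD1JointEndSymReflTablesAn1S2MW (d1Drift_JsB12Sym_an1TablesS2_of_bordReflLetters_D1Tel_D1Rep_of_locks)
open Summit.QuantumFields.BalabanUV.Beta.SymVhSliceReflectionAn1 (hVfm_sym hVmf_sym hVmm_sym)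
open Summit.QuantumFields.BalabanUV.Beta.SymRootedKernelReflection (hHr_sym)

namespace Summit.QuantumFields.BalabanUV.Beta.RowD1JointEndSymReflTablesAn1S2MWV

variable {Lc : ℕ} [NeZero Lc]

/-- **ROW D1 — THE LITERAL ROOT AT an1's CLOSED TABLE RECORD `symTablesAn1S2 3 Lc cΛ` WITH hW, THE FIRST-ORDER hR LETTERS AND THE SECOND UNITS LOCK
DISCHARGED** (locks `cΛ·Lc⁴ = 2`, `cB = −Lc¹²∕4` displayed): ROOT H `…S2MW.d1Drift_…_of_locks` with `hVfm hVmf hVmm hHr` SUPPLIED by an1's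
`SymVhSliceReflectionAn1.hVfm_sym ∕ hVmf_sym ∕ hVmm_sym`, `SymRootedKernelReflection.hHr_sym` and `hlock2` by `ring` on the weights — five binders fewer.  HONEST: composition by name;
NOT D1. -/
theorem d1Drift_JsB12Sym_an1TablesS2_of_secondOrderReflLetters_D1Tel_D1Rep_of_locks (hLc : Odd Lc) (hL2 : 2 ≤ Lc) {N : ℕ} (hN : 2 ≤ N) (cΛ cB : ℝ)
    -- the two unit locks of an1's TABLE-FIT tier 2 (Λ-lock of `SymMixedWardSiteLaw.symBondWardM`, B-lock of `SymBorderWardSiteLaw.symBondWardB`)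
    (hΛ : cΛ * (Lc : ℝ) ^ 4 = 2) (hcB : cB = -((Lc : ℝ) ^ 12 / 4))
    -- the first-order contact coefficient, displayed
    (γ : ℕ → ℝ) (hγ : ∀ j, γ j = -((Lc : ℝ) ^ 8 / 2) * wVH 3 Lc j / (stepScale 3 Lc j * (Lc : ℝ) ^ 4))
    -- hR, SECOND ORDER, TABLE-LEVEL: the second-order TABLE reflection letters
    -- (level-0 letter, mixed letter ∀ j, border letter ∀ j+1), the mechanical split identities + localisations, the remainder recursion (with the four
    -- inner sandwich-defect words of `SecondOrderInverseShapeDefect.K3_sharp_defect`) — the hypotheses of `SpineRooted.WrecOf_brefC_of_tableLetters_sym`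
    (h2 : ℕ → Fin 4 → Fin 4 → (Fin 4 → ℤ) → Fin 4 → (Fin 4 → ℤ) → (Fin 4 → ℤ) → Fib 3 → ℝ)
    (R2 : ℕ → Fin 4 → Fin 4 → (Fin 4 → ℤ) → Fin 4 → (Fin 4 → ℤ) → MKer 4 (Fib 3))
    (h0 : ∀ (α κ : Fin 4) (u : Fin 4 → ℤ) (κ' : Fin 4) (u' : Fin 4 → ℤ),
      T2RecOf 3 Lc (Gsym Lc) (SpureRecOf 3 Lc (symVhSAt (ctr 4 Lc) 3 Lc rfl) (symHessFFAt (ctr 4 Lc) Lc) (Gsym Lc) ((Lc : ℝ) ^ 4) (-((Lc : ℝ) ^ 8 / 2)) cΛ) (M1Of 3 Lc (symHessFFAt (ctr 4 Lc) Lc) cΛ) ((Lc : ℝ) ^ 8) cB ((8 * (N : ℝ) ^ 2)⁻¹ • wsym22 N) (symVh₂SAn1 3 Lc) (symMixFFAt (ctr 4 Lc) Lc) 0 κ (bref α κ u) κ' (bref α κ' u') =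
        (reflSign α κ * reflSign α κ') • refK (Φ Lc α)
          (T2RecOf 3 Lc (Gsym Lc) (SpureRecOf 3 Lc (symVhSAt (ctr 4 Lc) 3 Lc rfl) (symHessFFAt (ctr 4 Lc) Lc) (Gsym Lc) ((Lc : ℝ) ^ 4) (-((Lc : ℝ) ^ 8 / 2)) cΛ) (M1Of 3 Lc (symHessFFAt (ctr 4 Lc) Lc) cΛ) ((Lc : ℝ) ^ 8) cB ((8 * (N : ℝ) ^ 2)⁻¹ • wsym22 N) (symVh₂SAn1 3 Lc) (symMixFFAt (ctr 4 Lc) Lc) 0 κ u κ' u' +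
            conjW (bhKStepSh 3 Lc (Dsh Lc) 0) (SpureRecOf 3 Lc (symVhSAt (ctr 4 Lc) 3 Lc rfl) (symHessFFAt (ctr 4 Lc) Lc) (Gsym Lc) ((Lc : ℝ) ^ 4) (-((Lc : ℝ) ^ 8 / 2)) cΛ 0 κ u) (SpureRecOf 3 Lc (symVhSAt (ctr 4 Lc) 3 Lc rfl) (symHessFFAt (ctr 4 Lc) Lc) (Gsym Lc) ((Lc : ℝ) ^ 4) (-((Lc : ℝ) ^ 8 / 2)) cΛ 0 κ' u')
              (diagK fun p c => γ 0 * ctGenM 3 (bhK Lc + Dsh Lc) α Lc κ u p c) (diagK fun p c => γ 0 * ctGenM 3 (bhK Lc + Dsh Lc) α Lc κ' u' p c) (diagK (h2 0 α κ u κ' u')) +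
            R2 0 α κ u κ' u'))
    (X2s : ℕ → Fin 4 → Fin 4 → (Fin 4 → ℤ) → Fin 4 → (Fin 4 → ℤ) → (Fin 4 → ℤ) → Fib 3 → ℝ)
    (Δ : ℕ → Fin 4 → Fin 4 → (Fin 4 → ℤ) → Fin 4 → (Fin 4 → ℤ) → MKer 4 (Fib 3))
    (hsplit : ∀ (j : ℕ) (α μ : Fin 4) (y : Fin 4 → ℤ) (ν : Fin 4) (y' : Fin 4 → ℤ),
      W2OfK (Gsym (d := 3) Lc j) Lc
          (fun κ u => SpureRecOf 3 Lc (symVhSAt (ctr 4 Lc) 3 Lc rfl) (symHessFFAt (ctr 4 Lc) Lc) (Gsym Lc) ((Lc : ℝ) ^ 4) (-((Lc : ℝ) ^ 8 / 2)) cΛ j κ u + conjV (bhKStepSh 3 Lc (Dsh Lc) j) (diagK fun p c => γ j * ctGenM 3 (bhK Lc + Dsh Lc) α Lc κ u p c))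
          (M1Of 3 Lc (symHessFFAt (ctr 4 Lc) Lc) cΛ j)
          (fun κ u κ' u' => T2RecOf 3 Lc (Gsym Lc) (SpureRecOf 3 Lc (symVhSAt (ctr 4 Lc) 3 Lc rfl) (symHessFFAt (ctr 4 Lc) Lc) (Gsym Lc) ((Lc : ℝ) ^ 4) (-((Lc : ℝ) ^ 8 / 2)) cΛ) (M1Of 3 Lc (symHessFFAt (ctr 4 Lc) Lc) cΛ) ((Lc : ℝ) ^ 8) cB ((8 * (N : ℝ) ^ 2)⁻¹ • wsym22 N) (symVh₂SAn1 3 Lc) (symMixFFAt (ctr 4 Lc) Lc) j κ u κ' u' +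
            conjW (bhKStepSh 3 Lc (Dsh Lc) j) (SpureRecOf 3 Lc (symVhSAt (ctr 4 Lc) 3 Lc rfl) (symHessFFAt (ctr 4 Lc) Lc) (Gsym Lc) ((Lc : ℝ) ^ 4) (-((Lc : ℝ) ^ 8 / 2)) cΛ j κ u) (SpureRecOf 3 Lc (symVhSAt (ctr 4 Lc) 3 Lc rfl) (symHessFFAt (ctr 4 Lc) Lc) (Gsym Lc) ((Lc : ℝ) ^ 4) (-((Lc : ℝ) ^ 8 / 2)) cΛ j κ' u')
              (diagK fun p c => γ j * ctGenM 3 (bhK Lc + Dsh Lc) α Lc κ u p c) (diagK fun p c => γ j * ctGenM 3 (bhK Lc + Dsh Lc) α Lc κ' u' p c) (diagK (h2 j α κ u κ' u')) +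
            R2 j α κ u κ' u')
          (fun κ u ρ w => M2Of 3 Lc (symMixFFAt (ctr 4 Lc) Lc) j κ u ρ w + conjV (M1Of 3 Lc (symHessFFAt (ctr 4 Lc) Lc) cΛ j ρ w) (diagK fun p c => γ j * ctGenM 3 (bhK Lc + Dsh Lc) α Lc κ u p c) + symRMrAn1 Lc cΛ γ j α κ u ρ w)
          μ y ν y' =
        W2OfK (Gsym (d := 3) Lc j) Lc (SpureRecOf 3 Lc (symVhSAt (ctr 4 Lc) 3 Lc rfl) (symHessFFAt (ctr 4 Lc) Lc) (Gsym Lc) ((Lc : ℝ) ^ 4) (-((Lc : ℝ) ^ 8 / 2)) cΛ j) (M1Of 3 Lc (symHessFFAt (ctr 4 Lc) Lc) cΛ j)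
            (T2RecOf 3 Lc (Gsym Lc) (SpureRecOf 3 Lc (symVhSAt (ctr 4 Lc) 3 Lc rfl) (symHessFFAt (ctr 4 Lc) Lc) (Gsym Lc) ((Lc : ℝ) ^ 4) (-((Lc : ℝ) ^ 8 / 2)) cΛ) (M1Of 3 Lc (symHessFFAt (ctr 4 Lc) Lc) cΛ) ((Lc : ℝ) ^ 8) cB ((8 * (N : ℝ) ^ 2)⁻¹ • wsym22 N) (symVh₂SAn1 3 Lc) (symMixFFAt (ctr 4 Lc) Lc) j)
            (M2Of 3 Lc (symMixFFAt (ctr 4 Lc) Lc) j) μ y ν y' +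
          conjW (bhKStepSh 3 Lc (Dsh Lc) j)
            (dM (Gsym Lc j) Lc (SpureRecOf 3 Lc (symVhSAt (ctr 4 Lc) 3 Lc rfl) (symHessFFAt (ctr 4 Lc) Lc) (Gsym Lc) ((Lc : ℝ) ^ 4) (-((Lc : ℝ) ^ 8 / 2)) cΛ j) (M1Of 3 Lc (symHessFFAt (ctr 4 Lc) Lc) cΛ j) μ y)
            (dM (Gsym Lc j) Lc (SpureRecOf 3 Lc (symVhSAt (ctr 4 Lc) 3 Lc rfl) (symHessFFAt (ctr 4 Lc) Lc) (Gsym Lc) ((Lc : ℝ) ^ 4) (-((Lc : ℝ) ^ 8 / 2)) cΛ j) (M1Of 3 Lc (symHessFFAt (ctr 4 Lc) Lc) cΛ j) ν y')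
            (diagK fun p c => ∑ κ, ∑' u, colH (Gsym Lc j) Lc μ y κ u * (γ j * ctGenM 3 (bhK Lc + Dsh Lc) α Lc κ u p c))
            (diagK fun p c => ∑ κ, ∑' u, colH (Gsym Lc j) Lc ν y' κ u * (γ j * ctGenM 3 (bhK Lc + Dsh Lc) α Lc κ u p c))
            (diagK (X2s j α μ y ν y')) +
          Δ j α μ y ν y')
    (hDg : ∀ (j : ℕ) (α ν : Fin 4) (y' : Fin 4 → ℤ),
      Loc (dM (Gsym (d := 3) Lc j) Lc (fun κ u => SpureRecOf 3 Lc (symVhSAt (ctr 4 Lc) 3 Lc rfl) (symHessFFAt (ctr 4 Lc) Lc) (Gsym Lc) ((Lc : ℝ) ^ 4) (-((Lc : ℝ) ^ 8 / 2)) cΛ j κ u + conjV (bhKStepSh 3 Lc (Dsh Lc) j) (diagK fun p c => γ j * ctGenM 3 (bhK Lc + Dsh Lc) α Lc κ u p c)) (M1Of 3 Lc (symHessFFAt (ctr 4 Lc) Lc) cΛ j) ν y'))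
    (hX2L : ∀ j α μ y ν y', Loc (diagK (X2s j α μ y ν y'))) (hΔL : ∀ j α μ y ν y', Loc (Δ j α μ y ν y'))
    (RBr : ℕ → Fin 4 → Fin 4 → (Fin 4 → ℤ) → Fin 4 → (Fin 4 → ℤ) → MKer 4 (Fib 3))
    (hRBrff : ∀ j α κ u κ' u' (x z : Fin 4 → ℤ) (β β' : Fin 4), RBr j α κ u κ' u' x z (Sum.inl β) (Sum.inl β') = 0)
    (hBfm : ∀ (j : ℕ) (α : Fin 4) κ u κ' u' (x z : Fin 4 → ℤ) (β m : Fin 4),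
      ((cB * wB2 3 Lc (j + 1)) • symVh₂SAn1 3 Lc κ (bref α κ u) κ' (bref α κ' u')) x z (Sum.inl β) (Sum.inr m) =
        ((reflSign α κ * reflSign α κ') • refK (Φ Lc α) ((cB * wB2 3 Lc (j + 1)) • symVh₂SAn1 3 Lc κ u κ' u' +
          conjW (bhKStepSh 3 Lc (Dsh Lc) (j + 1)) (SpureRecOf 3 Lc (symVhSAt (ctr 4 Lc) 3 Lc rfl) (symHessFFAt (ctr 4 Lc) Lc) (Gsym Lc) ((Lc : ℝ) ^ 4) (-((Lc : ℝ) ^ 8 / 2)) cΛ (j + 1) κ u) (SpureRecOf 3 Lc (symVhSAt (ctr 4 Lc) 3 Lc rfl) (symHessFFAt (ctr 4 Lc) Lc) (Gsym Lc) ((Lc : ℝ) ^ 4) (-((Lc : ℝ) ^ 8 / 2)) cΛ (j + 1) κ' u')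
            (diagK fun p c => γ (j + 1) * ctGenM 3 (bhK Lc + Dsh Lc) α Lc κ u p c) (diagK fun p c => γ (j + 1) * ctGenM 3 (bhK Lc + Dsh Lc) α Lc κ' u' p c)
            (diagK (h2 (j + 1) α κ u κ' u')) + RBr (j + 1) α κ u κ' u')) x z (Sum.inl β) (Sum.inr m))
    (hBmf : ∀ (j : ℕ) (α : Fin 4) κ u κ' u' (x z : Fin 4 → ℤ) (m β : Fin 4),
      ((cB * wB2 3 Lc (j + 1)) • symVh₂SAn1 3 Lc κ (bref α κ u) κ' (bref α κ' u')) x z (Sum.inr m) (Sum.inl β) =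
        ((reflSign α κ * reflSign α κ') • refK (Φ Lc α) ((cB * wB2 3 Lc (j + 1)) • symVh₂SAn1 3 Lc κ u κ' u' +
          conjW (bhKStepSh 3 Lc (Dsh Lc) (j + 1)) (SpureRecOf 3 Lc (symVhSAt (ctr 4 Lc) 3 Lc rfl) (symHessFFAt (ctr 4 Lc) Lc) (Gsym Lc) ((Lc : ℝ) ^ 4) (-((Lc : ℝ) ^ 8 / 2)) cΛ (j + 1) κ u) (SpureRecOf 3 Lc (symVhSAt (ctr 4 Lc) 3 Lc rfl) (symHessFFAt (ctr 4 Lc) Lc) (Gsym Lc) ((Lc : ℝ) ^ 4) (-((Lc : ℝ) ^ 8 / 2)) cΛ (j + 1) κ' u')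
            (diagK fun p c => γ (j + 1) * ctGenM 3 (bhK Lc + Dsh Lc) α Lc κ u p c) (diagK fun p c => γ (j + 1) * ctGenM 3 (bhK Lc + Dsh Lc) α Lc κ' u' p c)
            (diagK (h2 (j + 1) α κ u κ' u')) + RBr (j + 1) α κ u κ' u')) x z (Sum.inr m) (Sum.inl β))
    (hBmm : ∀ (j : ℕ) (α : Fin 4) κ u κ' u' (x z : Fin 4 → ℤ) (m m' : Fin 4),
      ((cB * wB2 3 Lc (j + 1)) • symVh₂SAn1 3 Lc κ (bref α κ u) κ' (bref α κ' u')) x z (Sum.inr m) (Sum.inr m') =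
        ((reflSign α κ * reflSign α κ') • refK (Φ Lc α) ((cB * wB2 3 Lc (j + 1)) • symVh₂SAn1 3 Lc κ u κ' u' +
          conjW (bhKStepSh 3 Lc (Dsh Lc) (j + 1)) (SpureRecOf 3 Lc (symVhSAt (ctr 4 Lc) 3 Lc rfl) (symHessFFAt (ctr 4 Lc) Lc) (Gsym Lc) ((Lc : ℝ) ^ 4) (-((Lc : ℝ) ^ 8 / 2)) cΛ (j + 1) κ u) (SpureRecOf 3 Lc (symVhSAt (ctr 4 Lc) 3 Lc rfl) (symHessFFAt (ctr 4 Lc) Lc) (Gsym Lc) ((Lc : ℝ) ^ 4) (-((Lc : ℝ) ^ 8 / 2)) cΛ (j + 1) κ' u')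
            (diagK fun p c => γ (j + 1) * ctGenM 3 (bhK Lc + Dsh Lc) α Lc κ u p c) (diagK fun p c => γ (j + 1) * ctGenM 3 (bhK Lc + Dsh Lc) α Lc κ' u' p c)
            (diagK (h2 (j + 1) α κ u κ' u')) + RBr (j + 1) α κ u κ' u')) x z (Sum.inr m) (Sum.inr m'))
    (hR2succ : ∀ (j : ℕ) (α κ : Fin 4) (u : Fin 4 → ℤ) (κ' : Fin 4) (u' : Fin 4 → ℤ),
      R2 (j + 1) α κ u κ' u' =
          (-((((Lc : ℝ) ^ 8) * wV4 3 Lc (j + 1)) • mmRead Lc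
              (comp (comp (Gsym Lc j) (((1 / 2 : ℝ) • conjV (bhKStepSh 3 Lc (Dsh Lc) j) (diagK fun p a => X2s j α κ' u' κ u p a - X2s j α κ u κ' u' p a) +
                (1 / 2 : ℝ) • (Δ j α κ u κ' u' + Δ j α κ' u' κ u)))) (Gsym Lc j) -
                (comp (sandwichDefect (Gsym Lc j) (bhKStepSh 3 Lc (Dsh Lc) j)
                      (diagK fun p c => ∑ ι, ∑' v, colH (Gsym Lc j) Lc κ u ι v * (γ j * ctGenM 3 (bhK Lc + Dsh Lc) α Lc ι v p c)))
                    (comp (dM (Gsym Lc j) Lc (SpureRecOf 3 Lc (symVhSAt (ctr 4 Lc) 3 Lc rfl) (symHessFFAt (ctr 4 Lc) Lc) (Gsym Lc) ((Lc : ℝ) ^ 4) (-((Lc : ℝ) ^ 8 / 2)) cΛ j) (M1Of 3 Lc (symHessFFAt (ctr 4 Lc) Lc) cΛ j) κ' u') (Gsym Lc j) -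
                      diagK fun p c => ∑ ι, ∑' v, colH (Gsym Lc j) Lc κ' u' ι v * (γ j * ctGenM 3 (bhK Lc + Dsh Lc) α Lc ι v p c))
                  + comp (comp (Gsym Lc j) (dM (Gsym Lc j) Lc (SpureRecOf 3 Lc (symVhSAt (ctr 4 Lc) 3 Lc rfl) (symHessFFAt (ctr 4 Lc) Lc) (Gsym Lc) ((Lc : ℝ) ^ 4) (-((Lc : ℝ) ^ 8 / 2)) cΛ j) (M1Of 3 Lc (symHessFFAt (ctr 4 Lc) Lc) cΛ j) κ u +
                      conjV (bhKStepSh 3 Lc (Dsh Lc) j) (diagK fun p c => ∑ ι, ∑' v, colH (Gsym Lc j) Lc κ u ι v * (γ j * ctGenM 3 (bhK Lc + Dsh Lc) α Lc ι v p c))))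
                    (sandwichDefect (Gsym Lc j) (bhKStepSh 3 Lc (Dsh Lc) j)
                      (diagK fun p c => ∑ ι, ∑' v, colH (Gsym Lc j) Lc κ' u' ι v * (γ j * ctGenM 3 (bhK Lc + Dsh Lc) α Lc ι v p c)))
                  + comp (sandwichDefect (Gsym Lc j) (bhKStepSh 3 Lc (Dsh Lc) j)
                      (diagK fun p c => ∑ ι, ∑' v, colH (Gsym Lc j) Lc κ' u' ι v * (γ j * ctGenM 3 (bhK Lc + Dsh Lc) α Lc ι v p c)))
                    (comp (dM (Gsym Lc j) Lc (SpureRecOf 3 Lc (symVhSAt (ctr 4 Lc) 3 Lc rfl) (symHessFFAt (ctr 4 Lc) Lc) (Gsym Lc) ((Lc : ℝ) ^ 4) (-((Lc : ℝ) ^ 8 / 2)) cΛ j) (M1Of 3 Lc (symHessFFAt (ctr 4 Lc) Lc) cΛ j) κ u) (Gsym Lc j) -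
                      diagK fun p c => ∑ ι, ∑' v, colH (Gsym Lc j) Lc κ u ι v * (γ j * ctGenM 3 (bhK Lc + Dsh Lc) α Lc ι v p c))
                  + comp (comp (Gsym Lc j) (dM (Gsym Lc j) Lc (SpureRecOf 3 Lc (symVhSAt (ctr 4 Lc) 3 Lc rfl) (symHessFFAt (ctr 4 Lc) Lc) (Gsym Lc) ((Lc : ℝ) ^ 4) (-((Lc : ℝ) ^ 8 / 2)) cΛ j) (M1Of 3 Lc (symHessFFAt (ctr 4 Lc) Lc) cΛ j) κ' u' +
                      conjV (bhKStepSh 3 Lc (Dsh Lc) j) (diagK fun p c => ∑ ι, ∑' v, colH (Gsym Lc j) Lc κ' u' ι v * (γ j * ctGenM 3 (bhK Lc + Dsh Lc) α Lc ι v p c))))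
                    (sandwichDefect (Gsym Lc j) (bhKStepSh 3 Lc (Dsh Lc) j)
                      (diagK fun p c => ∑ ι, ∑' v, colH (Gsym Lc j) Lc κ u ι v * (γ j * ctGenM 3 (bhK Lc + Dsh Lc) α Lc ι v p c)))))) +
            RBr (j + 1) α κ u κ' u' +
            conjV (mmRead Lc (Gsym (d := 3) Lc j))
              (diagK fun p c => ((Lc : ℝ) ^ 8) * wV4 3 Lc (j + 1) * mmSym Lc (X2s j α κ u κ' u') p c - wVH 3 Lc (j + 1) * h2 (j + 1) α κ u κ' u' p c)))
    -- the cancellation of the chart-(II) defect against the W-REMAINDER `Rm_j` (the compensator is now IDENTIFIED: `Wc := Rm`, `X₂ := diagK X2s`) — the (N8) object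
    (hcomp : ∀ (j : ℕ) (α μ : Fin 4) (y : Fin 4 → ℤ) (ν : Fin 4) (y' : Fin 4 → ℤ),
      (1 / 2 : ℝ) * tadpole (coDressKSymAt (toSite (ctrOff 4 Lc)) Lc (KInvStep (d := 3) Lc j))
        ((1 / 2 : ℝ) • conjV (bhKStepSh 3 Lc (Dsh Lc) j) (diagK fun p a => X2s j α ν y' μ y p a - X2s j α μ y ν y' p a) +
          (1 / 2 : ℝ) • (Δ j α μ y ν y' + Δ j α ν y' μ y))
        + conjDefect (coDressKSymAt (toSite (ctrOff 4 Lc)) Lc (KInvStep (d := 3) Lc j)) (bhKStepSh 3 Lc (Dsh Lc) j)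
            (vertexOfK (coDressKSymAt (toSite (ctrOff 4 Lc)) Lc (KInvStep (d := 3) Lc j)) Lc (JsB12Sym0 hLc N (symTablesAn1S2 3 Lc cΛ) cΛ cB j).S μ y)
            (vertexOfK (coDressKSymAt (toSite (ctrOff 4 Lc)) Lc (KInvStep (d := 3) Lc j)) Lc (JsB12Sym0 hLc N (symTablesAn1S2 3 Lc cΛ) cΛ cB j).S ν y')
            (vertexOfK (coDressKSymAt (toSite (ctrOff 4 Lc)) Lc (KInvStep (d := 3) Lc j)) Lc (fun κ u => γ j • diagK (ctGenM 3 (bhK Lc + Dsh Lc) α Lc κ u)) μ y)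
            (vertexOfK (coDressKSymAt (toSite (ctrOff 4 Lc)) Lc (KInvStep (d := 3) Lc j)) Lc (fun κ u => γ j • diagK (ctGenM 3 (bhK Lc + Dsh Lc) α Lc κ u)) ν y')
            (diagK (X2s j α μ y ν y')) = 0)
    -- the route theorem's own binders, verbatim
    (a : ℝ) (ha : 0 < a)
    (h12 : B5.Prop12Printed (fam (fun i : ℕ+ × ℕ => ((i.1 : ℕ+) : ℕ)) (fun i => i.1.pos) MvE a ha))
    (h126 : B5.Kernel126_127Printed (kfam (fun i : ℕ+ × ℕ => ((i.1 : ℕ+) : ℕ)) MvE))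
    {L : Type*} {SL : Finset L} (hSL : SL.Nonempty) (k : L → Fin 4) {μ ν : Fin 4} (hμν : μ ≠ ν) {Nc : ℝ} (hNc : Nc ≠ 0)
    (Jc : ∀ m : ℕ, JetData 3 (Lc ^ m))
    (htel : D1Tel Lc (JsB12Sym hLc N (symTablesAn1S2 3 Lc cΛ) cΛ cB) Jc)
    {cc : ℝ} {Mw' : ℕ → ℕ} (hc : 1 ≤ cc) (hMwin : ∀ L : ℕ, 2 ≤ L → 1 ≤ Mw' L ∧ (L : ℝ) ≤ cc * Mw' L) (hML : ∀ L : ℕ, 2 ≤ L → Mw' L ≤ L)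
    (hrep : D1Rep Lc Jc Nc μ ν a SL k) :
    D1Drift Lc (JsB12Sym hLc N (symTablesAn1S2 3 Lc cΛ) cΛ cB) Nc μ ν := by
  have hlock2 : ∀ j : ℕ, ((Lc : ℝ) ^ 8) * wV4 3 Lc (j + 1) * wVH 3 Lc (j + 1) = ((Lc : ℝ) ^ 4 * wE 3 Lc (j + 1)) ^ 2 := fun j => by
    simp only [BalabanStepW2.wV4, BalabanStepJetsSucc.wVH, BalabanStepJetsSucc.wE]
    ring
  exact d1Drift_JsB12Sym_an1TablesS2_of_bordReflLetters_D1Tel_D1Rep_of_locks hLc hL2 hN cΛ cB hΛ hcB (hVfm_sym hLc) (hVmf_sym hLc) (hVmm_sym hLc)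
    (hHr_sym hLc) γ hγ hlock2 h2 R2 h0 X2s Δ hsplit hDg hX2L hΔL RBr hRBrff hBfm hBmf hBmm hR2succ hcomp a ha h12 h126 hSL k hμν hNc Jc htel hc hMwin hML
    hrep

end Summit.QuantumFields.BalabanUV.Beta.RowD1JointEndSymReflTablesAn1S2MWV

end
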